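import Summits.BirchSwinnertonDyer.Rank1Residual.X12.O11.RouteUTheoremU
import Summits.BirchSwinnertonDyer.Rank1Residual.X12.O11.RouteUTraceForm
import Summits.BirchSwinnertonDyer.Rank1Residual.X12.O11.RouteUPsiD11
import Summits.BirchSwinnertonDyer.Rank1Residual.X12.O11.RouteUInvMulOmega
import Summits.BirchSwinnertonDyer.Rank1Residual.X12.O11.RouteUTwistReduction
import Summits.BirchSwinnertonDyer.Rank1Residual.X12.O11.RouteUHeegnerFieldD11
import Summits.BirchSwinnertonDyer.Rank1Residual.X12.O11.RouteUTwistCM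
import Summits.BirchSwinnertonDyer.Rank1Residual.X12.O11.RouteUSevenBinders
import Summits.BirchSwinnertonDyer.Rank1Residual.X12.O11.RouteUSelmerSha
import Summits.BirchSwinnertonDyer.Rank1Residual.X12.O11.RouteUBernoulliD11
import Summits.BirchSwinnertonDyer.Rank1Residual.X12.O11.RouteUBernoulliCharChangeLevel
import Summits.BirchSwinnertonDyer.Rank1Residual.X12.O11.RouteUTwinD11
import Summits.BirchSwinnertonDyer.Rank1Residual.X12.O11.RouteUTamagawaCM
import Summits.BirchSwinnertonDyer.Rank1Residual.X12.O11.RouteUPrimePsi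
import Literature.NumberTheory.EllipticCurves.KrizLi2019.TeichmullerCharacterExists
import HarnessLib

/-!
# ROUTE U for `D = −11` (`N = 5929 = 7²·11²`): BSD₇ for the minimal models of `49a1^{(−11)}`

bsd-cm cell, ROUTE U (Theorem U: BSD(49a1^{(D)}, 7) ⇒ full BSD on `𝒞₇`), first residual
discriminant `D = −11` of `R_U49`, Heegner field `K'' = ℚ(√−19)`. This file SPECIALISES the kernel
theorem T-U5 (`bsdp_of_thm120_of_rem310`) and DISCHARGES every character-side and field-side
hypothesis of Kriz–Li Thm. 1.20 for this member:

* `ψ = χ_{−11}·ω²` primitive of conductor `77` (`RouteUPsiD11`), `ω` Teichmüller (EXISTS: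
  `exists_isTeichmullerCharacter`), `χ_{−11}` (EXISTS: `exists_legendreCharacter`);
* the trace hypothesis `E[7]^{ss} ≅ 𝔽₇(ψ) ⊕ 𝔽₇(ψ⁻¹ω)` (`hss_twist_cm7` + `psiD11_traceIdentity`,
  from (E49) `a_ℓ(49a1) ≡ ℓ² + ℓ⁵ (mod 7)`);
* (1) `ψ(7) ≠ 1`, `(ψ⁻¹ω)(7) ≠ 1`; (3) at the only additive prime `ℓ = 11 ≠ 7`
  (`RouteUTwistReduction`): `ψ(11) ≠ 1`, `(ψ⁻¹ω)(11) ≠ 1` (`RouteUInvMulOmega`);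
  (2) no split multiplicative prime (CM, `RouteUTwistCM` + `RouteUSevenBinders`);
* `K''`: Heegner hypothesis for `N(W)`, `7` split, `7 ∤ w_K = 2` (`RouteUHeegnerFieldD11`);
  `ε_K = (·/19)` (ibid.), whence the Bernoulli unit hypothesis `hB` from the mod-`7²` certificates
  (`RouteUBernoulliD11`), transported from level `19` to level `|d_K|` (`RouteUBernoulliCharChangeLevel` +
  `bernoulliOnePrim_changeLevel` below);
* `#Ẽ^{ns}(𝔽₇) = 7` (`hns`), `7 ∤ #Ш(W)` from `#Sel₇(W) ∣ 7` (`RouteUSelmerSha`).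

What REMAINS as displayed hypotheses (`bsdp_seven_of_twist_cm7_D11`): the named facts (Thm. 1.20,
Rem. 3.10, Gross–Zagier, Kolyvagin, GZK, modularity), `r_an(W) = 1`, the Heegner datum
`(D, H, ι, ι₇, P)` over `K''` with `d_{K''} = −19`, the Mordell–Weil datum `(crd, g)` of level `0`
(`‖log_ω g‖₇ = 1`) with no `7`-torsion over `K''`, `#Sel₇(W) ∣ 7`, `7 ∤ ∏ c_ℓ(W)`, and the twin
`W^{(−19)}` data (`hLt`, `Wd`, `htw`, `htam`, `hu`, `hSd`). THEOREMS ONLY.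
-/

noncomputable section

open scoped Classical
open NumberField WeierstrassCurve DirichletCharacter
open Literature.NumberTheory.EllipticCurves Literature.NumberTheory.EllipticCurves.Rank1Residual
open Literature.NumberTheory.EllipticCurves.KrizLi2019 Literature.NumberTheory.LFunctions
open Literature.NumberTheory.EllipticCurves.ModularForms

namespace Summit.BirchSwinnertonDyer.Rank1Residual.X12.O11.RouteU

/-! ## §2 BSD₇ for the minimal models of `49a1^{(−11)}` -/

/-- **ROUTE U, member `D = −11` (`N = 5929`)**: `BSD₇(W)` for every globally minimal `W/ℚ` with
`C • W = 49a1^{(−11)}` and `r_an(W) = 1`, from Kriz–Li Thm. 1.20 + Rem. 3.10 (named facts) at the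
Heegner field `K'' = ℚ(√−19)`, with ALL character/field hypotheses of Thm. 1.20 discharged
(`ψ = χ_{−11}ω²`, `ω`, `ε_K = (·/19)`, (1), (2), (3), trace form, Heegner hypothesis, `7` split,
`w_K`, Bernoulli units by certificate, `#Ẽ^{ns}(𝔽₇) = 7`). The remaining displayed hypotheses are
the Heegner/Mordell–Weil data, `#Sel₇ ∣ 7`, `7 ∤ ∏ c_ℓ`, and the twin `W^{(−19)}`.
[cite: KrizLi2019, Thm. 1.20 and Rem. 3.10] [cite: GrossZagier1986, I.(6.5) and V.(2.1)]
[cite: Miller2011LMS, Thm. 2.5 and (5.1)] -/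
theorem bsdp_seven_of_twist_cm7_D11
    (hKL : KrizLi2019.thm120_padicLogHeegner_unit_of_bernoulli)
    (hRem : KrizLi2019.rem310_padicLogHeegner_integral)
    (W : WeierstrassCurve ℚ) [W.IsElliptic] [W.IsGloballyMinimal] [NeZero (W.conductorNorm ℤ)]
    (hW : ∃ C : VariableChange ℚ, C • W = cm7.quadraticTwist ((-11 : ℤ) : ℚ))
    (K : Type) [Field K] [NumberField K] [NeZero (NumberField.discr K).natAbs]
    (hK : IsImaginaryQuadratic K) (hdK : NumberField.discr K = -19)
    (D : ModularParametrizationData W (W.conductorNorm ℤ))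
    (H : HeegnerDatum (W.conductorNorm ℤ) (NumberField.discr K)) (ι : K →+* ℂ) (ιp : K →+* ℚ_[7])
    (P : (W.baseChange K).toAffine.Point)
    (hGZ : gross_zagier (W.conductorNorm ℤ) W K) (hKo : kolyvagin (W.conductorNorm ℤ) W K)
    (hGZK : rank_eq_analyticRank_of_analyticRank_le_one) (hmod : hasEntireLFunction_rat)
    (hP : WeierstrassCurve.Affine.Point.map ι.toRatAlgHom P = heegnerPointComplex D H)
    (hr : W.analyticRank = 1)
    (hLt : (W.quadraticTwist (NumberField.discr K : ℚ)).entireLFunction 1 ≠ 0)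
    (Wd : WeierstrassCurve ℚ) [Wd.IsElliptic] [Wd.IsGloballyMinimal] (Cd : VariableChange ℚ)
    (hWd : Cd • W.quadraticTwist (NumberField.discr K : ℚ) = Wd)
    (htw : ∃ q : ℚ, Wd.entireLFunction 1 / (Wd.realPeriodRat : ℂ) = (q : ℂ) ∧
      padicValRat 7 q = (padicValNat 7 Wd.shaOrder : ℤ) + padicValNat 7 Wd.tamagawaProduct -
        2 * padicValNat 7 Wd.torsionOrder)
    (htam : padicValNat 7 Wd.tamagawaProduct = padicValNat 7 W.tamagawaProduct)
    (hu : padicValRat 7 (Cd.u : ℚ) = 0)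
    (htamW : ¬ 7 ∣ W.tamagawaProduct)
    (hSel : Nat.card (W.selmerGroup (7 : ℤ)) ∣ 7) (hSd : ∀ [Finite Wd.sha], ¬ 7 ∣ Wd.shaOrder)
    (εK : DirichletCharacter ℚ_[7] (NumberField.discr K).natAbs)
    (hεK : KrizLi2019.IsKroneckerCharacterOf K εK)
    [Finite (AddCommGroup.torsion (W.baseChange K).toAffine.Point)]
    (crd : (W.baseChange K).toAffine.Point →+ ℤ) (g : (W.baseChange K).toAffine.Point)
    (hg : crd g = 1) (hker : ∀ x, crd x = 0 → IsOfFinAddOrder x)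
    (hiv : ∀ x : (W.baseChange K).toAffine.Point, 7 • x = 0 → x = 0)
    (hg0 : ‖Castella2018.padicLogOmega W 7 ιp g‖ = 1) :
    BSDp W 7 := by
  haveI : NeZero (77 : ℕ) := ⟨by norm_num⟩
  -- the characters: `ω` Teichmüller mod 7, `χ = χ_{−11}` mod 11, `ψ = χ·ω²` mod 77
  obtain ⟨ω, hω⟩ := exists_isTeichmullerCharacter (p := 7)
  obtain ⟨χ, hχ⟩ := exists_legendreCharacter 11
  have hχ1 : χ ≠ 1 := legendre11_ne_one χ hχ
  set ψ : DirichletCharacter ℚ_[7] 77 :=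
    changeLevel (by norm_num : 11 ∣ 77) χ * changeLevel (by norm_num : 7 ∣ 77) (ω ^ 2) with hψdef
  -- CM data of `W`
  have h11 : (-11 : ℤ) ≠ 0 := by norm_num
  have hCM : W.HasCM := hasCM_of_twist_cm7 W h11 hW
  have hKj : cmFieldDiscrOfJ W.j = -7 := cmFieldDiscrOfJ_of_twist_cm7 W h11 hW
  -- the trace hypothesis
  have hss : ∀ ℓ : ℕ, ℓ.Prime → ¬ (ℓ ∣ 7 * W.conductorNorm ℤ) →
      ‖((W.LFunction ℓ : ℤ) : ℚ_[7]) - (ψ (ℓ : ZMod 77) + ψ⁻¹ (ℓ : ZMod 77) * ω (ℓ : ZMod 7))‖ < 1 := by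
    have hsq : Squarefree (-11 : ℤ) := by
      rw [← Int.squarefree_natAbs]
      exact (Nat.prime_iff.mp (by norm_num : Nat.Prime 11)).squarefree
    refine hss_twist_cm7 W (D := -11) (by decide) hsq (by decide) hW ψ ω hω fun ℓ hℓ hℓN => ?_
    haveI := Fact.mk hℓ
    have h7 : ¬ 7 ∣ ℓ := by
      intro h
      have : ℓ = 7 := ((Nat.prime_dvd_prime_iff_eq (by norm_num) hℓ).mp h).symm
      subst this
      exact hℓN (dvd_mul_right 7 _)
    have hnat : (-11 : ℤ).natAbs = 11 := rfl
    rw [hnat, ← jacobiSym.legendreSym.to_jacobiSym]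
    by_cases h11ℓ : 11 ∣ ℓ
    · -- `ℓ = 11`: both sides vanish
      have : ℓ = 11 := ((Nat.prime_dvd_prime_iff_eq (by norm_num) hℓ).mp h11ℓ).symm
      subst this
      have hnu : ¬ IsUnit ((11 : ℕ) : ZMod 77) := by
        rw [ZMod.isUnit_iff_coprime]; norm_num
      rw [MulChar.map_nonunit _ hnu, MulChar.map_nonunit _ hnu, zero_mul, add_zero,
        (legendreSym.eq_zero_iff 11 _).mpr (by exact_mod_cast ZMod.natCast_self 11), Int.cast_zero,
        zero_mul]
    · rw [hψdef]
      exact psiD11_traceIdentity ω χ hχ ℓ h7 h11ℓ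
  -- the Kronecker character at level 19 and the Bernoulli hypothesis
  have h19 : (NumberField.discr K).natAbs = 19 := natAbs_discr_of_discr_eq_neg19 hdK
  have hdiv : (NumberField.discr K).natAbs ∣ 19 := ⟨1, by rw [h19]⟩
  set ε : DirichletCharacter ℚ_[7] 19 := changeLevel hdiv εK with hεdef
  have hval19 : ∀ ℓ : ℕ, ℓ.Prime → ¬ ((ℓ : ℤ) ∣ NumberField.discr K) →
      ε (ℓ : ZMod 19) =
        if ((Ideal.span {(ℓ : ℤ)}).primesOver (𝓞 K)).ncard = 2 then 1 else -1 :=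
    changeLevel_apply_prime_eq_of_forall hdiv εK (NumberField.discr K)
      (fun ℓ hℓ hℓ19 => by
        rw [hdK, (Nat.prime_dvd_prime_iff_eq hℓ (by norm_num)).mp hℓ19]
        decide)
      (fun ℓ => if ((Ideal.span {(ℓ : ℤ)}).primesOver (𝓞 K)).ncard = 2 then 1 else -1) hεK.2
  have hε : ∀ a : ℕ, ε (a : ZMod 19) = (legendreSym 19 (a : ℤ) : ℚ_[7]) :=
    kroneckerCharacter_apply_of_discr_eq_neg19 hK hdK ε hval19
  have hBε := bernoulli_hypothesis_D11 ω hω χ hχ ε hε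
  haveI i1 : NeZero (77 * 19) := ⟨by norm_num⟩
  haveI i2 : NeZero (77 * (NumberField.discr K).natAbs) := ⟨by rw [h19]; norm_num⟩
  haveI i3 : NeZero (77 * 19 * 7) := ⟨by norm_num⟩
  haveI i4 : NeZero (77 * (NumberField.discr K).natAbs * 7) := ⟨by rw [h19]; norm_num⟩
  have e1 : bernoulliOnePrim (bernoulliCharOne ψ ε) = bernoulliOnePrim (bernoulliCharOne ψ εK) := by
    rw [hεdef, bernoulliCharOne_changeLevel, bernoulliOnePrim_changeLevel]
  have e2 : bernoulliOnePrim (bernoulliCharTwo ψ ε ω) =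
      bernoulliOnePrim (bernoulliCharTwo ψ εK ω) := by
    rw [hεdef, bernoulliCharTwo_changeLevel, bernoulliOnePrim_changeLevel]
  have hB : ¬ (‖bernoulliOnePrim (bernoulliCharOne ψ εK) *
      bernoulliOnePrim (bernoulliCharTwo ψ εK ω)‖ ≤ (7 : ℝ)⁻¹) := by
    rw [← e1, ← e2]; exact hBε
  -- assemble T-U5
  exact bsdp_of_thm120_of_rem310 hKL hRem W 7 K D H ι ιp P hGZ hKo hGZK hmod hK
    (satisfiesHeegnerHypothesis_conductorNorm_of_discr_eq_neg19 hK hdK W fun q hq h7 hbad => by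
      haveI := Fact.mk hq
      exact eq_eleven_of_not_hasGoodReductionAtPrime_twist_cm7_D11 W hW q h7 hbad)
    hP (by norm_num)
    (not_seven_dvd_unitsTorsionOrder hK (discr_lt_neg_four_of_discr_eq_neg19 hdK))
    hr hLt Wd Cd hWd htw htam hu htamW
    (fun {_} => not_dvd_shaOrder_of_analyticRank_eq_one hGZK W 7 hr hSel) hSd
    77 ψ ω (psiD11_isPrimitive ω χ hω hχ) hω hss
    (psi_D11_seven_ne_one ψ)
    (primVal_invMulOmega_D11_seven_ne_one χ hχ1 ω hω)
    (not_hasSplitMultiplicativeReductionAtPrime_of_hasCM W hCM)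
    (thm120_hyp3_of_eleven_D11 W hW
      (fun ℓ => ψ (ℓ : ZMod 77) ≠ 1 ∧ primVal (invMulOmega ψ ω) ℓ ≠ 1)
      ⟨psi_D11_eleven_ne_one ψ, primVal_invMulOmega_D11_eleven_ne_one χ hχ1 ω hω⟩)
    (ncard_primesOver_seven_eq_two_of_discr_eq_neg19 hK hdK)
    εK hεK hB
    (nsPointCount_seven_of_cmFieldDiscr_eq W hCM hKj)
    crd g hg hker hiv hg0

/-- **ROUTE U, member `D = −11` (`N = 5929`), Manin-unit / twin-by-name form**: as
`bsdp_seven_of_twist_cm7_D11`, but (i) WITHOUT the level-zero generator hypothesis `hg0`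
(`‖log_ω g‖₇ = 1`, the data-dependent «`n(D) = 0`»), replaced by `hc7 : ¬ 7 ∣ c` (the Manin
constant of the parametrisation `D`; in print a `7`-unit for the optimal curve, Agashe–Ribet–Stein
2006 Thm. 2.6, `N = 5929 ≤ 130000`) via T-U2′ (`RouteUHeegnerIndexLevelZero`: `log_{ω_E}` is
`7`-integral at the additive prime `7`), and (ii) WITHOUT the twin binder `hSd`, replaced by the
published named fact `hC : Rubin1983.thmC_seven_quadraticField` (Rubin 1983 Thm C at `p = 7` over
`ℚ(√209)`), whose Bernoulli conditions are kernel certificates (`RouteUTwinD11`); (iii) WITHOUT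
the twin's value binder `htw`, replaced by the published named fact
`hBF : bsdTriple_of_hasCM_of_L_one_ne_zero` (Burungale–Flach 2024: full BSD for CM curves with
`L(1) ≠ 0`; `RouteUTwinD11.twin_value_D11`); (iv) WITHOUT `htamW` (`7 ∤ ∏ c_ℓ(W)`: every CM curve,
Kodaira–Néron, `RouteUTamagawaCM`). Remaining displayed hypotheses: the named facts (Thm. 1.20,
Rem. 3.10, GZ, Kolyvagin, GZK, modularity, Rubin Thm C, Burungale–Flach), `r_an(W) = 1`, the
Heegner datum over `K''` (`d_{K''} = −19`), the Mordell–Weil datum `(crd, g)` with no `7`-torsion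
over `K''`, `#Sel₇(W) ∣ 7` (paper: UD-PI-PROOF.md, (U-D-π)), `7 ∤ c`, and the twin's model data
`hLt`/`Wd`/`Cd`/`hWd`/`hu` (`htam` is derived: both Tamagawa products are `7`-units).
[cite: KrizLi2019, Thm. 1.20 and Rem. 3.10] [cite: Rubin1983, §0 Thm. C (p. 341)]
[cite: BurungaleFlach2024, Thm 1.1 and Cor. 2] [cite: GrossZagier1986, I.(6.5) and V.(2.1)]
[cite: Miller2011LMS, Thm. 2.5 and (5.1)] -/
theorem bsdp_seven_of_twist_cm7_D11'
    (hKL : KrizLi2019.thm120_padicLogHeegner_unit_of_bernoulli)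
    (hRem : KrizLi2019.rem310_padicLogHeegner_integral)
    (W : WeierstrassCurve ℚ) [W.IsElliptic] [W.IsGloballyMinimal] [NeZero (W.conductorNorm ℤ)]
    (hW : ∃ C : VariableChange ℚ, C • W = cm7.quadraticTwist ((-11 : ℤ) : ℚ))
    (K : Type) [Field K] [NumberField K] [NeZero (NumberField.discr K).natAbs]
    (hK : IsImaginaryQuadratic K) (hdK : NumberField.discr K = -19)
    (D : ModularParametrizationData W (W.conductorNorm ℤ))
    (H : HeegnerDatum (W.conductorNorm ℤ) (NumberField.discr K)) (ι : K →+* ℂ) (ιp : K →+* ℚ_[7])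
    (P : (W.baseChange K).toAffine.Point)
    (hGZ : gross_zagier (W.conductorNorm ℤ) W K) (hKo : kolyvagin (W.conductorNorm ℤ) W K)
    (hGZK : rank_eq_analyticRank_of_analyticRank_le_one) (hmod : hasEntireLFunction_rat)
    (hP : WeierstrassCurve.Affine.Point.map ι.toRatAlgHom P = heegnerPointComplex D H)
    (hr : W.analyticRank = 1)
    (hLt : (W.quadraticTwist (NumberField.discr K : ℚ)).entireLFunction 1 ≠ 0)
    (Wd : WeierstrassCurve ℚ) [Wd.IsElliptic] [Wd.IsGloballyMinimal] (Cd : VariableChange ℚ)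
    (hWd : Cd • W.quadraticTwist (NumberField.discr K : ℚ) = Wd)
    (hBF : bsdTriple_of_hasCM_of_L_one_ne_zero)
    (hu : padicValRat 7 (Cd.u : ℚ) = 0)
    (hSel : Nat.card (W.selmerGroup (7 : ℤ)) ∣ 7) (hC : Rubin1983.thmC_seven_quadraticField)
    (εK : DirichletCharacter ℚ_[7] (NumberField.discr K).natAbs)
    (hεK : KrizLi2019.IsKroneckerCharacterOf K εK)
    [Finite (AddCommGroup.torsion (W.baseChange K).toAffine.Point)]
    (crd : (W.baseChange K).toAffine.Point →+ ℤ) (g : (W.baseChange K).toAffine.Point)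
    (hg : crd g = 1) (hker : ∀ x, crd x = 0 → IsOfFinAddOrder x)
    (hiv : ∀ x : (W.baseChange K).toAffine.Point, 7 • x = 0 → x = 0)
    (hc7 : ¬ ((7 : ℤ) ∣ D.c)) :
    BSDp W 7 := by
  haveI : NeZero (77 : ℕ) := ⟨by norm_num⟩
  -- the characters: `ω` Teichmüller mod 7, `χ = χ_{−11}` mod 11, `ψ = χ·ω²` mod 77
  obtain ⟨ω, hω⟩ := exists_isTeichmullerCharacter (p := 7)
  obtain ⟨χ, hχ⟩ := exists_legendreCharacter 11
  have hχ1 : χ ≠ 1 := legendre11_ne_one χ hχ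
  set ψ : DirichletCharacter ℚ_[7] 77 :=
    changeLevel (by norm_num : 11 ∣ 77) χ * changeLevel (by norm_num : 7 ∣ 77) (ω ^ 2) with hψdef
  -- CM data of `W`
  have h11 : (-11 : ℤ) ≠ 0 := by norm_num
  have hCM : W.HasCM := hasCM_of_twist_cm7 W h11 hW
  have hKj : cmFieldDiscrOfJ W.j = -7 := cmFieldDiscrOfJ_of_twist_cm7 W h11 hW
  -- the trace hypothesis
  have hss : ∀ ℓ : ℕ, ℓ.Prime → ¬ (ℓ ∣ 7 * W.conductorNorm ℤ) →
      ‖((W.LFunction ℓ : ℤ) : ℚ_[7]) - (ψ (ℓ : ZMod 77) + ψ⁻¹ (ℓ : ZMod 77) * ω (ℓ : ZMod 7))‖ < 1 := by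
    have hsq : Squarefree (-11 : ℤ) := by
      rw [← Int.squarefree_natAbs]
      exact (Nat.prime_iff.mp (by norm_num : Nat.Prime 11)).squarefree
    refine hss_twist_cm7 W (D := -11) (by decide) hsq (by decide) hW ψ ω hω fun ℓ hℓ hℓN => ?_
    haveI := Fact.mk hℓ
    have h7 : ¬ 7 ∣ ℓ := by
      intro h
      have : ℓ = 7 := ((Nat.prime_dvd_prime_iff_eq (by norm_num) hℓ).mp h).symm
      subst this
      exact hℓN (dvd_mul_right 7 _)
    have hnat : (-11 : ℤ).natAbs = 11 := rfl
    rw [hnat, ← jacobiSym.legendreSym.to_jacobiSym]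
    by_cases h11ℓ : 11 ∣ ℓ
    · -- `ℓ = 11`: both sides vanish
      have : ℓ = 11 := ((Nat.prime_dvd_prime_iff_eq (by norm_num) hℓ).mp h11ℓ).symm
      subst this
      have hnu : ¬ IsUnit ((11 : ℕ) : ZMod 77) := by
        rw [ZMod.isUnit_iff_coprime]; norm_num
      rw [MulChar.map_nonunit _ hnu, MulChar.map_nonunit _ hnu, zero_mul, add_zero,
        (legendreSym.eq_zero_iff 11 _).mpr (by exact_mod_cast ZMod.natCast_self 11), Int.cast_zero,
        zero_mul]
    · rw [hψdef]
      exact psiD11_traceIdentity ω χ hχ ℓ h7 h11ℓ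
  -- the Kronecker character at level 19 and the Bernoulli hypothesis
  have h19 : (NumberField.discr K).natAbs = 19 := natAbs_discr_of_discr_eq_neg19 hdK
  have hdiv : (NumberField.discr K).natAbs ∣ 19 := ⟨1, by rw [h19]⟩
  set ε : DirichletCharacter ℚ_[7] 19 := changeLevel hdiv εK with hεdef
  have hval19 : ∀ ℓ : ℕ, ℓ.Prime → ¬ ((ℓ : ℤ) ∣ NumberField.discr K) →
      ε (ℓ : ZMod 19) =
        if ((Ideal.span {(ℓ : ℤ)}).primesOver (𝓞 K)).ncard = 2 then 1 else -1 :=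
    changeLevel_apply_prime_eq_of_forall hdiv εK (NumberField.discr K)
      (fun ℓ hℓ hℓ19 => by
        rw [hdK, (Nat.prime_dvd_prime_iff_eq hℓ (by norm_num)).mp hℓ19]
        decide)
      (fun ℓ => if ((Ideal.span {(ℓ : ℤ)}).primesOver (𝓞 K)).ncard = 2 then 1 else -1) hεK.2
  have hε : ∀ a : ℕ, ε (a : ZMod 19) = (legendreSym 19 (a : ℤ) : ℚ_[7]) :=
    kroneckerCharacter_apply_of_discr_eq_neg19 hK hdK ε hval19
  have hBε := bernoulli_hypothesis_D11 ω hω χ hχ ε hε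
  haveI i1 : NeZero (77 * 19) := ⟨by norm_num⟩
  haveI i2 : NeZero (77 * (NumberField.discr K).natAbs) := ⟨by rw [h19]; norm_num⟩
  haveI i3 : NeZero (77 * 19 * 7) := ⟨by norm_num⟩
  haveI i4 : NeZero (77 * (NumberField.discr K).natAbs * 7) := ⟨by rw [h19]; norm_num⟩
  have e1 : bernoulliOnePrim (bernoulliCharOne ψ ε) = bernoulliOnePrim (bernoulliCharOne ψ εK) := by
    rw [hεdef, bernoulliCharOne_changeLevel, bernoulliOnePrim_changeLevel]
  have e2 : bernoulliOnePrim (bernoulliCharTwo ψ ε ω) =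
      bernoulliOnePrim (bernoulliCharTwo ψ εK ω) := by
    rw [hεdef, bernoulliCharTwo_changeLevel, bernoulliOnePrim_changeLevel]
  have hB : ¬ (‖bernoulliOnePrim (bernoulliCharOne ψ εK) *
      bernoulliOnePrim (bernoulliCharTwo ψ εK ω)‖ ≤ (7 : ℝ)⁻¹) := by
    rw [← e1, ← e2]; exact hBε
  -- assemble T-U5
  -- the twin side BY NAME (Rubin 1983 Thm C and Burungale–Flach 2024, `RouteUTwinD11`), the
  -- Tamagawa binder (`RouteUTamagawaCM`), and additivity at `7`
  have hSd : ∀ [Finite Wd.sha], ¬ 7 ∣ Wd.shaOrder := fun {_} =>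
    not_seven_dvd_shaOrder_twin_D11 hC W hW Wd Cd (by rw [← hWd, hdK])
  have htw := twin_value_D11 hBF hGZK hmod W hW Wd Cd (by rw [← hWd, hdK]) (by rw [← hdK]; exact hLt)
  have htamW : ¬ 7 ∣ W.tamagawaProduct :=
    not_dvd_tamagawaProduct_of_hasCM W hCM 7 (by norm_num) (by norm_num)
  have htam : padicValNat 7 Wd.tamagawaProduct = padicValNat 7 W.tamagawaProduct := by
    rw [padicValNat.eq_zero_of_not_dvd htamW, padicValNat.eq_zero_of_not_dvd
      (not_dvd_tamagawaProduct_of_hasCM Wd (hasCM_twin_D11 W hW Wd Cd (by rw [← hWd, hdK])) 7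
        (by norm_num) (by norm_num))]
  have hadd : Addv W 7 :=
    X12.addv_of_hasCM_of_cmRamified W 7 hCM (by norm_num) (by rw [CMRamified, hKj]; norm_num)
  exact bsdp_of_thm120_of_rem310_of_not_dvd hKL hRem W 7 K D H ι ιp P hGZ hKo hGZK hmod hK
    (satisfiesHeegnerHypothesis_conductorNorm_of_discr_eq_neg19 hK hdK W fun q hq h7 hbad => by
      haveI := Fact.mk hq
      exact eq_eleven_of_not_hasGoodReductionAtPrime_twist_cm7_D11 W hW q h7 hbad)
    hP (by norm_num)
    (not_seven_dvd_unitsTorsionOrder hK (discr_lt_neg_four_of_discr_eq_neg19 hdK))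
    hr hLt Wd Cd hWd htw htam hu htamW
    (fun {_} => not_dvd_shaOrder_of_analyticRank_eq_one hGZK W 7 hr hSel) hSd
    77 ψ ω (psiD11_isPrimitive ω χ hω hχ) hω hss
    (psi_D11_seven_ne_one ψ)
    (primVal_invMulOmega_D11_seven_ne_one χ hχ1 ω hω)
    (not_hasSplitMultiplicativeReductionAtPrime_of_hasCM W hCM)
    (thm120_hyp3_of_eleven_D11 W hW
      (fun ℓ => ψ (ℓ : ZMod 77) ≠ 1 ∧ primVal (invMulOmega ψ ω) ℓ ≠ 1)
      ⟨psi_D11_eleven_ne_one ψ, primVal_invMulOmega_D11_eleven_ne_one χ hχ1 ω hω⟩)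
    (ncard_primesOver_seven_eq_two_of_discr_eq_neg19 hK hdK)
    εK hεK hB
    (nsPointCount_seven_of_cmFieldDiscr_eq W hCM hKj)
    crd g hg hker hiv hadd (by norm_num) hc7

end Summit.BirchSwinnertonDyer.Rank1Residual.X12.O11.RouteU

end
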